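import Literature.MathematicalPhysics.QuantumFieldTheory.Balaban1983to89.B8Thm2TorusCoverOfEBlock
import Literature.MathematicalPhysics.QuantumFieldTheory.Balaban1983to89.B9B8KnitBondBootstrap

/-!
# `Balaban1983to89.B8Thm2TorusCoverOfEBlockSym` — sub-row G-B8-T2S, JB-BOND file 4: [Balaban1985RegularSpaces] THEOREM 2 AT THE COVER TORUS OF EVERY MEMBER `(F, n, K)`
# WITH THE (Δa) BINDER AT def-Y's LETTER OF RECORD `parSymY` — per shape-member `IsUnit Δ_a(U; parSymY)` + the (3.42) block `EBlock(G_a(U; parSymY))` of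
# [Balaban1985BackgroundPropagators] Thm 3.3's class reading (the conclusion currency of M5.7's `eBlock_kernelFamilyBInv_GAY_of_localInverseCubes''` AT ITS OWN
# LETTER) + the ONE junction inequality `|(D_U P_sym D*_U − D_U P_knit D*_U)A|₍₋₃₎ ≤ κ|A|₍₋₁₎` (JB-BOND file 2) — the knit∕taxicab junction of the bond sector CLOSED
# modulo that inequality by files 1 + 3 ((3.106)'s resolvent bootstrap)

statement-level skeleton of published theorems with citation tags; proofs where landed; nothing here is a claim about the Yang–Mills mass gap

T. Bałaban, *Spaces of regular gauge field configurations on a lattice and gauge fixing conditions*, Commun. Math. Phys. **99** (1985) 75–102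
[`Balaban1985RegularSpaces`, "[B8]"]: Thm 2 p. 83, (1.29) p. 81, (1.33)–(1.39) pp. 82–83, (1.38) p. 82, p. 77, Prop. 3 (1.58)–(1.60) pp. 86–87.
T. Bałaban, *Propagators for lattice gauge theories in a background field*, Commun. Math. Phys. **99** (1985) 389–434 [`Balaban1985BackgroundPropagators`, "[B9]"]:
(3.19) p. 393 («(52), (53) in [5]» — the knit letter), (3.40) p. 397 («a shortest contour» — def-Y's `parSymY`), (3.25)–(3.27) p. 395, (3.41)–(3.42) p. 397, (3.47) p. 398,
Thm 3.3 p. 399, (3.101) p. 414, (3.106) p. 414, Thm 3.11 p. 416, p. 408 l. 30–34.  [4] = [`Balaban1984PropagatorsII`]: (2.50) p. 232, Lemma 2.1 (2.59)–(2.61) pp. 233–234,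
(2.66) p. 234.  [`Balaban1985UV3`] (1)–(3) p. 256.  Rows B8.Thm2 × B9.Thm3.3 × B9.Eq3.106 (cells only; no row head changes).

WHY (lead g34 RULING JUNCTION-PARS, (T) CONFIRMED 2026-08-28T23:20Z; design memo `pub/lit-balaban/lit-balaban-t2s-1/g10/JB-BOND-DESIGN.md` v2).  G9
(`B8Thm2TorusCoverOfEBlock`) displays the (Δa) family at `parS := parKnitY i` — forced by the knit's Landau condition — whereas the whole G-B9-LETTERS road (M5.1b-G →
M5.7) is typed at `parSymY` and cannot be re-keyed by cosmetics (p38's parS census: Thm 3.11's `isUnit_XCubeY_parSymY`, the Reg335Y chain and the `parSY` kernel readings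
are `parSymY`-essential).  FILE 1 (`B9B8KnitBondResolvent`) isolated the difference `Δ_a(knit) − Δ_a(sym) = D_U(P_sym − P_knit)D*_U`; FILE 3 (`B9B8KnitBondBootstrap`)
transfers the FOUR Δ_a-side members from one letter to another given a weighted bound `κ` on that difference with `2(d+3)B₀κ ≤ 1`.  THIS FILE composes: M5.7's endpoint
currency AT `parSymY` ((1ₛ) `IsUnit`, (Eₛ) `EBlock`, reading-generic) ⟹ [G7 §5 with the section discharged, §1] the three members at `parSymY` at
`B_E·c₁(d′,δ_E,1−α)·L⁴` ⟹ [FILE 3, given (J)] the four members at `parKnitY` at twice that ⟹ [G6b §2′ ∕ G8] Thm 2.  What remains displayed per member: (1ₛ), (Eₛ)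
— M5.7's to supply BY NAME at its own letter — and (J), FILE 2's target (p38); plus the junction window on `κ` and the geometry (discharged in §5).

WHAT IS PROVED (all `theorem`s; 0 `def`, 0 `… : Prop` fact, 0 sorry).
* §1 ★ `three_of_eBlock_at` (any `𝔸`, any letter `O`, any reading) — G7 §5 `wNormBY_three_of_eBlock` with the section of `β` DISCHARGED at a constant-level index
  (`i.k = n + 1`; G9 §1): `EBlock (kernelFamilyBInv i B cfg O par) B_E δ_E c` + (2.60)∕(2.61)∕size ⇒ the three weighted members of `O (cfg c)` at `B_E·c₁(d′,δ_E,1−α)·L⁴`.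
* §2 ★★ `deltaAFour_of_eBlockSym` (any `d`, `M_N(ℂ)`) — the FOUR-member binder of F10′∕G6b∕G8 AT `parKnitY` at `B₀ := 2·B_E·c₁·L⁴` FROM `hgeo` + the binder AT `parSymY`
  [(1ₛ) ∧ (Eₛ) ∧ (J)] under `2((d+3)(B_E·c₁·L⁴)κ) ≤ 1` (§1 at the one-point reading + FILE 3 `deltaAFour_transfer'`).
* §3 ★★★★★ `thm2TorusAtSU_ofProp6_eBlockSym_exists` — G6b §2′ (any `d`, `SU(N)`, both halves, (3.35) dropped) at that `B₀` with the `parSymY` binder, `hgeo` displayed.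
* §4 ★★★★★ `hThm2Cover_of_prop6_eBlockSym` — G8 (`d + 1 = 3`, `N = 2`, cover torus, `P ∣ P′ ∧ L^{K−n} ∣ P ∧ Thm2TorusAt …`) likewise.
* §5 ★★★★★ `hThm2Cover_of_prop6_eBlockSym_exists` — §4 with the geometry DISCHARGED (G9 §5 `exists_geo_threshold`): `∃ d′ A₀, ∀ a′ ≥ A₀, ∀ B_E > 0, ∀ κ ≥ 0` with the
  window, `∀ a_T` (windows + F7's numeric condition at `B₀`), §4's conclusion.

INTERFACE OF RECORD AFTER THIS FILE (beside G9's `parKnitY` form): §5 — [B8] Thm 2 (both halves, `SU(2)`, `Reg := ⊤`, (3.35) dropped) at the cover torus of every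
`(F, n, K)` MODULO, per shape-member `i` of the cover torus (`1 ≤ m′ ≤ K − n`, `i.k = m′+1`, `i.Mh = L^{a′}`, `a′ ≥ A₀`) and `U(2)`-valued periodic `U₀ ∈ 𝔄_{m′}(T_η, α₀)`,
`α₀ ≤ a_T`, `U = bgY i U₀`: (1ₛ) `IsUnit (deltaAY i (parSymY i) (parBY i) (GpY i (parSymY i)) U)`, (Eₛ) `∀ B cfg par U₁, cfg U₁ = U → EBlock (kernelFamilyBInv i B cfg (GAY i
(parSymY i) (parBY i) (GpY i (parSymY i))) par) B_E δ_E U₁`, (J) `∀ A, |(DPDsY i parSymY G′_s U − DPDsY i parKnitY G′_k U)A|₍₋₃₎ ≤ κ|A|₍₋₁₎`.  FILE 5 (when FILE 2 lands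
with `κ = κ(a_T) → 0`) removes (J).

HONEST SCOPE ∕ NOT CLAIMED.  Composition BY NAME (G6b §2′, G8, G7 §5, G9 §1∕§5, FILES 1∕3); NO estimate of [B8]∕[B9]∕[4] proved here; (1ₛ), (Eₛ), (J) displayed, inhabited
by nothing in this file; constants doubled by the bootstrap; `SU(2)`, `d + 1 = 3` in §4–§5 (§1–§3 general); sup-entries only (`β₀ = 0`); count-neutral; no summit ∕
sub-problem statement is proved; NOT a node discharge; `stub_PV3A` NOT discharged; nothing continuum ∕ ℝ⁴ ∕ OS ∕ mass-gap ∕ Clay — the Yang–Mills mass gap is NOT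
proved by any of this.  No `sorry`, no `axiom`, no `def`, no `instance`, no `notation`.  NEW file.  Cell `lit-balaban`, seat `lit-balaban-t2s-1` gen 10, 2026-08-28;
`--supports stmt-QuantumFields-19200`.
-/

noncomputable section

open scoped BigOperators

namespace Literature.MathematicalPhysics.QuantumFieldTheory.Balaban1983to89.B8Thm2TorusCoverOfEBlockSym

open Node00 B6KLevelCensusIndexV1
open B7Prop1Explicit renaming Site → LSite
open B7Prop2Explicit (unitaryUnits C0 c2')
open B6GlobalChartV1 (PV)
open B6Ineq2142KLevelV1 (β)
open B6RandomWalk (Ineq260 Ineq261)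
open B9Thm34Ext (toB6)
open B9FromB6 (EBlock)
open B9CubeLettersInvReadings (kernelFamilyBInv)
open B9GeoNormsKLevelV1 (geo9K)
open B9GeoInputsMultiRateKLevelV1 (geo9K_L_eq)
open B9Ineq347BondReadingYInv (wNormBY_three_of_eBlock)
open B9Eq3104CutoffCommutators (DPDsY)
open B8Thm2TorusCoverOfEBlock (surjective_beta_kIdx_of_constLev B₀_pos exists_geo_threshold)
open B9B8KnitBondBootstrap (deltaAFour_transfer')
open B8Ineq132 (InAk)
open B8Thm2TorusLettersPerOfKnit (bgY)
open B9B8AveragingJunction (parKnitY)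
open B9Eq316AveragingTransposeZd (betaTau alphaQ)
open B7Prop2SpecialUnitary (specialUnitaryUnits)
open B8Thm2TorusAt (Thm2TorusAt)
open T4TermwiseTorus (IsPeriodic)
open scoped Matrix Matrix.Norms.L2Operator

variable {d ℓ : ℕ} {hd : 1 ≤ d + 1} {hL : Odd (ℓ + 1) ∧ 1 < ℓ + 1} {b₀ b₁ : ℝ}

/-! ## §1 The three weighted members of `G_a` AT ANY LETTER from the (3.42) block of the class reading and [4] Lemma 2.1 (G9 §2, letter-generic) -/

section AnyLetter

variable {𝔸 : Type} [NormedRing 𝔸] [NormedAlgebra ℂ 𝔸] [CompleteSpace 𝔸] [FiniteDimensional ℝ 𝔸]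

/-- ★ **THE THREE WEIGHTED MEMBERS OF `G_a(U; parS, parB, G′)` AT ANY LETTER** from the (3.42) block `EBlock (kernelFamilyBInv i B cfg (G_a) par) B_E δ_E U₁` of ANY
reading with `cfg U₁ = U`, at a k-level index of constant level `n` with `i.k = n + 1` (so `β` has a section, G9 §1) and [4] (2.60) at `(δ_E, α)`, (2.61) at
`(δ_E, 1 − α)` with exponent `d′`, size `4·log L ≤ αδ_E·Rg·(L·M_h)`: at `U = cfg c`, `|OF|₍₋₁₎, |∇_{U,ν}OF|₍₋₂₎, |Δ_U OF|₍₋₃₎ ≤ (B_E·c₁(d′, δ_E, 1−α)·L⁴)|F|₍₋₃₎` — G7 §5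
`wNormBY_three_of_eBlock` with the section DISCHARGED, any letter `O`, any reading, any coefficient algebra. [cite: Balaban1985BackgroundPropagators, (3.42) p.397, (3.47) p.398, Thm 3.3 p.399; Balaban1984PropagatorsII, Lemma 2.1 (2.60)–(2.61) p.234, (2.3) p.224, (2.45) p.231] -/
theorem three_of_eBlock_at (i : KIdx d ℓ hd hL b₀ b₁) [Fintype (geo9K i).Site] {n : ℕ} (hk : i.k = n + 1) (hD : ∀ x, i.D.lev x = n)
    (B : B9.Backgrounds) (cfg : B.Cfg → CfgY 𝔸 i) (O : BondOpY 𝔸 i) (par : BondParY 𝔸 i) (c : B.Cfg)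
    (d' : ℕ) {Rg : ℝ} {Hg : Prop} {δE α BE : ℝ} (hBE : 0 ≤ BE)
    (h260 : Ineq260 (toB6 (geo9K i) Rg Hg) δE α) (h261 : Ineq261 d' (toB6 (geo9K i) Rg Hg) δE (1 - α))
    (hsize : 4 * Real.log (geo9K i).L ≤ α * δE * Rg * (geo9K i).M)
    (hE : EBlock (kernelFamilyBInv i B cfg O par) BE δE c) :
    (∀ F, wNormBY i (-1) (O (cfg c) F) ≤ (BE * B6.c1 d' δE (1 - α) * (((ℓ + 1 : ℕ) : ℝ)) ^ 4) * wNormBY i (-3) F) ∧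
    (∀ F ν, wNormBY i (-2) (cdB i (cfg c) ν (O (cfg c) F)) ≤ (BE * B6.c1 d' δE (1 - α) * (((ℓ + 1 : ℕ) : ℝ)) ^ 4) * wNormBY i (-3) F) ∧
    (∀ F, wNormBY i (-3) (lapB i (cfg c) (O (cfg c) F)) ≤ (BE * B6.c1 d' δE (1 - α) * (((ℓ + 1 : ℕ) : ℝ)) ^ 4) * wNormBY i (-3) F) := by
  have hsurj : Function.Surjective (β i.hN i.D i.hk) := surjective_beta_kIdx_of_constLev i hk hD
  have hι : ∀ s : BlkY i, β i.hN i.D i.hk (Function.surjInv hsurj s) = s := fun s => Function.surjInv_eq hsurj s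
  have h3 := wNormBY_three_of_eBlock i (Function.surjInv hsurj) hι B cfg O par c d' hBE hsize h260 h261 hE
  have hL4 : (geo9K i).L ^ (4 : ℝ) = (((ℓ + 1 : ℕ) : ℝ)) ^ 4 := by
    rw [geo9K_L_eq, show (4 : ℝ) = ((4 : ℕ) : ℝ) by norm_num, Real.rpow_natCast]
    push_cast; ring
  rw [hL4] at h3
  exact h3

end AnyLetter

/-! ## §2 ★★ The four-member (Δa) binder AT `parKnitY` from M5.7's endpoint AT `parSymY` + the junction inequality (J), member by member -/

section Binder

variable {N : ℕ}
variable [instF : ∀ i : KIdx d ℓ hd hL 1 1, Fintype (geo9K i).Site]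

/-- ★★ **THE FOUR-MEMBER BINDER OF F10′∕G6b∕G8 (AT `parKnitY`) FROM: the geometric data of the members with `i.Mh = L^{a′}`, and the binder AT `parSymY` — per
shape-member and admissible background `U = bgY i U₀`: (1ₛ) `IsUnit Δ_a(U; parSymY)`, (Eₛ) the (3.42) block of `G_a(U; parSymY)` for every class reading (M5.7's endpoint
currency VERBATIM), and (J) the junction inequality `|(D_U P_sym D*_U − D_U P_knit D*_U)A|₍₋₃₎ ≤ κ|A|₍₋₁₎` — under the window `2·((d+3)·(B_E·c₁(d′,δ_E,1−α)·L⁴)·κ) ≤ 1`;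
the four members at `parKnitY` come at `B₀ := 2·B_E·c₁(d′,δ_E,1−α)·L⁴` (JB-BOND file 3 `deltaAFour_transfer'` ∘ §1).
[cite: Balaban1985BackgroundPropagators, (3.25)–(3.27) p.395, (3.42) p.397, (3.47) p.398, (3.101) p.414, (3.106) p.414, Thm 3.11 p.416, (3.19) p.393, (3.40) p.397; Balaban1984PropagatorsII, (2.50) p.232, (2.66) p.234, Lemma 2.1 (2.60)–(2.61) p.234; Balaban1985RegularSpaces, Thm 2 p.83, (1.58)–(1.60) pp.86–87] -/
theorem deltaAFour_of_eBlockSym {a' K' m K : ℕ} {η aT : ℝ} (d' : ℕ) {Rg : ℝ} {Hg : Prop} {δE α BE κ : ℝ} (hBE : 0 ≤ BE) (hκ : 0 ≤ κ)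
    (hc1 : 0 ≤ B6.c1 d' δE (1 - α))
    (hθ : 2 * ((((d : ℝ) + 3) * (BE * B6.c1 d' δE (1 - α) * (((ℓ + 1 : ℕ) : ℝ)) ^ 4)) * κ) ≤ 1)
    (hgeo : ∀ i : KIdx d ℓ hd hL 1 1, i.Mh = (ℓ + 1) ^ a' →
      Ineq260 (toB6 (geo9K i) Rg Hg) δE α ∧ Ineq261 d' (toB6 (geo9K i) Rg Hg) δE (1 - α) ∧
      4 * Real.log (geo9K i).L ≤ α * δE * Rg * (geo9K i).M)
    (hΔS : letI : CStarAlgebra (Matrix (Fin N) (Fin N) ℂ) := {}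
      ∀ (i : KIdx d ℓ hd hL 1 1) (m' : ℕ), 1 ≤ m' → m' ≤ K' → i.k = m' + 1 → (∀ x, i.D.lev x = m') → i.Mh = (ℓ + 1) ^ a' →
      i.cf = (((ℓ + 1 : ℕ) : ℝ)) ^ (m' + 1) →
      (∀ ι : IBondY i, i.w ι = i.cf ^ 2 * (((((ℓ + 1 : ℕ) : ℝ)) ^ (ι.1.1 : ℕ)) ^ (d + 1) * (1 / (((ℓ + 1 : ℕ) : ℝ)) ^ (ι.1.1 : ℕ)) ^ 2)) →
      (PV d ℓ i.m i.K hd hL).sitesPerDir 0 = (PV d ℓ m K hd hL).sitesPerDir 0 →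
      ∀ (α₀ : ℝ) (U₀ : LSite (d + 1) → Fin (d + 1) → (Matrix (Fin N) (Fin N) ℂ)ˣ),
      (∀ x κ, U₀ x κ ∈ B7Prop2Explicit.unitaryUnits (Matrix (Fin N) (Fin N) ℂ)) →
      IsPeriodic ((PV d ℓ m K hd hL).sitesPerDir 0) U₀ → 0 < α₀ → α₀ ≤ aT →
      InAk (ℓ + 1) m' η α₀ (fun _ => (Set.univ : Set (LSite (d + 1)))) U₀ →
        IsUnit (deltaAY i (parSymY i) (parBY i) (GpY i (parSymY i)) (bgY i U₀)) ∧
        (∀ (B : B9.Backgrounds) (cfg : B.Cfg → CfgY (Matrix (Fin N) (Fin N) ℂ) i) (par : BondParY (Matrix (Fin N) (Fin N) ℂ) i) (U₁ : B.Cfg),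
          cfg U₁ = bgY i U₀ →
          EBlock (kernelFamilyBInv i B cfg (GAY i (parSymY i) (parBY i) (GpY i (parSymY i))) par) BE δE U₁) ∧
        (∀ A, wNormBY i (-3) ((DPDsY i (parSymY i) (GpY i (parSymY i)) (bgY i U₀) - DPDsY i (parKnitY i) (GpY i (parKnitY i)) (bgY i U₀)) A) ≤
          κ * wNormBY i (-1) A)) :
    letI : CStarAlgebra (Matrix (Fin N) (Fin N) ℂ) := {}
    ∀ (i : KIdx d ℓ hd hL 1 1) (m' : ℕ), 1 ≤ m' → m' ≤ K' → i.k = m' + 1 → (∀ x, i.D.lev x = m') → i.Mh = (ℓ + 1) ^ a' →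
      i.cf = (((ℓ + 1 : ℕ) : ℝ)) ^ (m' + 1) →
      (∀ ι : IBondY i, i.w ι = i.cf ^ 2 * (((((ℓ + 1 : ℕ) : ℝ)) ^ (ι.1.1 : ℕ)) ^ (d + 1) * (1 / (((ℓ + 1 : ℕ) : ℝ)) ^ (ι.1.1 : ℕ)) ^ 2)) →
      (PV d ℓ i.m i.K hd hL).sitesPerDir 0 = (PV d ℓ m K hd hL).sitesPerDir 0 →
      ∀ (α₀ : ℝ) (U₀ : LSite (d + 1) → Fin (d + 1) → (Matrix (Fin N) (Fin N) ℂ)ˣ),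
      (∀ x κ, U₀ x κ ∈ B7Prop2Explicit.unitaryUnits (Matrix (Fin N) (Fin N) ℂ)) →
      IsPeriodic ((PV d ℓ m K hd hL).sitesPerDir 0) U₀ → 0 < α₀ → α₀ ≤ aT →
      InAk (ℓ + 1) m' η α₀ (fun _ => (Set.univ : Set (LSite (d + 1)))) U₀ →
        IsUnit (deltaAY i (parKnitY i) (parBY i) (GpY i (parKnitY i)) (bgY i U₀)) ∧
        (∀ F, wNormBY i (-1) (GAY i (parKnitY i) (parBY i) (GpY i (parKnitY i)) (bgY i U₀) F) ≤
          (2 * (BE * B6.c1 d' δE (1 - α) * (((ℓ + 1 : ℕ) : ℝ)) ^ 4)) * wNormBY i (-3) F) ∧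
        (∀ F ν, wNormBY i (-2) (cdB i (bgY i U₀) ν (GAY i (parKnitY i) (parBY i) (GpY i (parKnitY i)) (bgY i U₀) F)) ≤
          (2 * (BE * B6.c1 d' δE (1 - α) * (((ℓ + 1 : ℕ) : ℝ)) ^ 4)) * wNormBY i (-3) F) ∧
        (∀ F, wNormBY i (-3) (lapB i (bgY i U₀) (GAY i (parKnitY i) (parBY i) (GpY i (parKnitY i)) (bgY i U₀) F)) ≤
          (2 * (BE * B6.c1 d' δE (1 - α) * (((ℓ + 1 : ℕ) : ℝ)) ^ 4)) * wNormBY i (-3) F) := by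
  letI : CStarAlgebra (Matrix (Fin N) (Fin N) ℂ) := {}
  intro i m' h1 h2 hk hD hMh hcf hw hper α₀ U₀ hU₀ hperU hα₀ hα₀T hAk
  obtain ⟨hUs, hEs, hJ⟩ := hΔS i m' h1 h2 hk hD hMh hcf hw hper α₀ U₀ hU₀ hperU hα₀ hα₀T hAk
  obtain ⟨h260, h261, hsize⟩ := hgeo i hMh
  -- the three members at `parSymY` (§1 at the one-point reading `cfg () := bgY i U₀`)
  let B : B9.Backgrounds :=
    { Cfg := Unit, one := (), mul := fun _ _ => (), Reg335 := fun _ _ _ => True, Reg336 := fun _ _ _ => True,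
      Cplx337 := fun _ _ _ => True, Cplx338 := fun _ _ _ => True }
  have h3 := three_of_eBlock_at i hk hD B (fun _ => bgY i U₀) (GAY i (parSymY i) (parBY i) (GpY i (parSymY i))) (parBY i) () d' hBE
    h260 h261 hsize (hEs B _ (parBY i) () rfl)
  -- the junction transfer (file 3)
  have hB₀' : 0 ≤ BE * B6.c1 d' δE (1 - α) * (((ℓ + 1 : ℕ) : ℝ)) ^ 4 := by positivity
  have h := deltaAFour_transfer' i (parKnitY i) (parSymY i) (parBY i) (GpY i (parKnitY i)) (GpY i (parSymY i)) (bgY i U₀) hB₀' hκ hθ hUs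
    h3.1 h3.2.1 h3.2.2 hJ
  simpa only [mul_assoc] using h

end Binder

/-! ## §3 ★★★★★ [B8] Thm 2 on the torus (both halves, `SU(N)`, `Reg := ⊤`, (3.35) dropped) modulo M5.7's endpoint AT `parSymY` + the junction inequality (J) -/

section Torus

variable {N : ℕ} [NeZero N]
variable [instF : ∀ i : KIdx d ℓ hd hL 1 1, Fintype (geo9K i).Site] [instD : ∀ i : KIdx d ℓ hd hL 1 1, DecidableEq (geo9K i).Site]

/-- ★★★★★ **G6b §2′ WITH THE BINDER AT def-Y's LETTER OF RECORD `parSymY`**: [B8] Thm 2 on `PV d ℓ m K` (both halves, `Thm2TorusAt`, `SU(N)`, `Reg := ⊤`, (3.35) dropped by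
Prop. 6) at `B₀ := 2·B_E·c₁(d′, δ_E, 1−α)·L⁴`, displayed: the geometric data `hgeo` of the members with `i.Mh = L^{a′}`, the junction window `2·((d+3)·(B_E·c₁·L⁴)·κ) ≤ 1`, and
per shape-member ∕ admissible background (1ₛ) `IsUnit Δ_a(U; parSymY)`, (Eₛ) `EBlock (kernelFamilyBInv i B cfg (GAY i (parSymY i) (parBY i) (GpY i (parSymY i))) par) B_E δ_E U₁`
for every reading with `cfg U₁ = bgY i U₀` (the conclusion currency of M5.7's `eBlock_kernelFamilyBInv_GAY_of_localInverseCubes''` at ITS letter), (J) the junction inequality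
`|(D_U P_sym D*_U − D_U P_knit D*_U)A|₍₋₃₎ ≤ κ|A|₍₋₁₎` (JB-BOND file 2).  Proof: G6b §2′ ∘ §2.  HONEST SCOPE: (1ₛ), (Eₛ), (J), `hgeo` displayed; `stub_PV3A` NOT discharged;
the Yang–Mills mass gap is NOT proved.
[cite: Balaban1985RegularSpaces, Thm 2 p.83, (1.33)–(1.39) pp.82–83, Prop. 6 p.99, p.77, p.76, (1.58)–(1.60) pp.86–87; Balaban1985BackgroundPropagators, p.408 l.30–34, (3.19) p.393, (3.25)–(3.27) p.395, (3.40) p.397, (3.42) p.397, (3.47) p.398, Thm 3.3 p.399, (3.101) p.414, (3.106) p.414, Thm 3.11 p.416; Balaban1984PropagatorsII, (2.50) p.232, Lemma 2.1 (2.60)–(2.61) p.234, (2.66) p.234; Balaban1985Averaging, (4) p.18, Prop. 2 p.26] -/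
theorem thm2TorusAtSU_ofProp6_eBlockSym_exists (hN : N ≤ 25) (hd2 : 2 ≤ d + 1) (hℓ : 4 ≤ ℓ)
    (τ : Matrix (Fin N) (Fin N) ℂ →ₗ[ℂ] ℂ) (hτ : ∀ a, τ a = Matrix.trace a) (hτt : ∀ a b, τ (a * b) = τ (b * a))
    {Cτ : ℝ} (hCτ : ∀ x y : Matrix (Fin N) (Fin N) ℂ, |(τ (star x * y)).re| ≤ Cτ * ‖x‖ * ‖y‖)
    {M : ℝ} (hM1 : 1 ≤ M) (d' : ℕ) {Rg : ℝ} {Hg : Prop} {δE α BE κ aT : ℝ} (hBE : 0 < BE) (hδE : 0 < δE) (hα1 : α < 1) (hκ : 0 ≤ κ)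
    (hθ : 2 * ((((d : ℝ) + 3) * (BE * B6.c1 d' δE (1 - α) * (((ℓ + 1 : ℕ) : ℝ)) ^ 4)) * κ) ≤ 1)
    (haT : 0 < aT) (haTQ : aT ≤ alphaQ (d + 1) (ℓ + 1) / ((ℓ + 1 : ℕ) : ℝ) ^ 2)
    (haT3 : C0 (d + 1) * aT ≤ 1 / 3) (haT2 : 2 * aT ≤ c2' (d + 1) (ℓ + 1))
    (hεB : 2 * ((48 * ((d : ℝ) + 1) + 14 * d * M + (32 * ((d : ℝ) + 2) ^ 2 +
        12 * ((d : ℝ) + 1) ^ 2 * (13344 * ((d : ℝ) + 1) * ((d : ℝ) + 2) ^ 2 * ((d : ℝ) + 5) * (((ℓ + 1 : ℕ) : ℝ)) ^ (d + 4)) *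
          (Cτ * (letI : CStarAlgebra (Matrix (Fin N) (Fin N) ℂ) := {}; betaTau τ)))) * aT) * (2 * (BE * B6.c1 d' δE (1 - α) * (((ℓ + 1 : ℕ) : ℝ)) ^ 4)) ≤ 1)
    {len : LSite (d + 1) → ℝ}
    {ι : Type} [Fintype ι] [DecidableEq ι] (b : Module.Basis ι ℝ (Matrix (Fin N) (Fin N) ℂ)) {M₂ : ℝ} (hM₂ : 0 ≤ M₂)
    (hrepr : ∀ (v : Matrix (Fin N) (Fin N) ℂ) (j : ι), |b.repr v j| ≤ M₂ * ‖v‖) (Rr : ℝ) (Hp : Prop) {a' : ℕ} (h8' : 8 ≤ (ℓ + 1) ^ a')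
    (hgeo : ∀ i : KIdx d ℓ hd hL 1 1, i.Mh = (ℓ + 1) ^ a' →
      Ineq260 (toB6 (geo9K i) Rg Hg) δE α ∧ Ineq261 d' (toB6 (geo9K i) Rg Hg) δE (1 - α) ∧
      4 * Real.log (geo9K i).L ≤ α * δE * Rg * (geo9K i).M) :
    letI : CStarAlgebra (Matrix (Fin N) (Fin N) ℂ) := {}
    ∃ a₀' : ℝ, 0 < a₀' ∧ ∃ k₀ : ℕ, ∃ cα : ℝ, 0 < cα ∧
    ∀ cL : ℝ, 0 < cL → cL * (((ℓ + 1 : ℕ) : ℝ)) ^ 2 < a₀' →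
      cL ≤ min (1 / 16) (min aT (min aT (1 / (2 * (2 * (2 * (BE * B6.c1 d' δE (1 - α) * (((ℓ + 1 : ℕ) : ℝ)) ^ 4))) * (14 * ((d + 1 - 1 : ℕ) : ℝ)) * M + 1)))) →
      cL ≤ cα →
    ∃ B₁ B₂ c₁ : ℝ, 0 < B₁ ∧ 0 < B₂ ∧ 0 < c₁ ∧ ∀ (m K k : ℕ) (η : ℝ), 1 ≤ k → k + k₀ ≤ m + K → 0 < η →
      (∀ (i : KIdx d ℓ hd hL 1 1) (m' : ℕ), 1 ≤ m' → m' ≤ k → i.k = m' + 1 → (∀ x, i.D.lev x = m') → i.Mh = (ℓ + 1) ^ a' →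
        i.cf = (((ℓ + 1 : ℕ) : ℝ)) ^ (m' + 1) →
        (∀ ι : IBondY i, i.w ι = i.cf ^ 2 * (((((ℓ + 1 : ℕ) : ℝ)) ^ (ι.1.1 : ℕ)) ^ (d + 1) * (1 / (((ℓ + 1 : ℕ) : ℝ)) ^ (ι.1.1 : ℕ)) ^ 2)) →
        (PV d ℓ i.m i.K hd hL).sitesPerDir 0 = (PV d ℓ m K hd hL).sitesPerDir 0 →
        ∀ (α₀ : ℝ) (U₀ : LSite (d + 1) → Fin (d + 1) → (Matrix (Fin N) (Fin N) ℂ)ˣ),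
        (∀ x κ, U₀ x κ ∈ B7Prop2Explicit.unitaryUnits (Matrix (Fin N) (Fin N) ℂ)) →
        IsPeriodic ((PV d ℓ m K hd hL).sitesPerDir 0) U₀ → 0 < α₀ → α₀ ≤ aT →
        InAk (ℓ + 1) m' η α₀ (fun _ => (Set.univ : Set (LSite (d + 1)))) U₀ →
          IsUnit (deltaAY i (parSymY i) (parBY i) (GpY i (parSymY i)) (bgY i U₀)) ∧
          (∀ (B : B9.Backgrounds) (cfg : B.Cfg → CfgY (Matrix (Fin N) (Fin N) ℂ) i) (par : BondParY (Matrix (Fin N) (Fin N) ℂ) i) (U₁ : B.Cfg),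
            cfg U₁ = bgY i U₀ →
            EBlock (kernelFamilyBInv i B cfg (GAY i (parSymY i) (parBY i) (GpY i (parSymY i))) par) BE δE U₁) ∧
          (∀ A, wNormBY i (-3) ((DPDsY i (parSymY i) (GpY i (parSymY i)) (bgY i U₀) - DPDsY i (parKnitY i) (GpY i (parKnitY i)) (bgY i U₀)) A) ≤
            κ * wNormBY i (-1) A)) →
      Thm2TorusAt (ℓ + 1) k ((((PV d ℓ m K hd hL).sitesPerDir 0 : ℕ) : ℤ)) η 0 B₁ B₂ c₁ len (specialUnitaryUnits (Fin N)) (fun _ => True) := by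
  letI : CStarAlgebra (Matrix (Fin N) (Fin N) ℂ) := {}
  have hB₀' : 0 < BE * B6.c1 d' δE (1 - α) * (((ℓ + 1 : ℕ) : ℝ)) ^ 4 := B₀_pos (ℓ := ℓ) d' hBE hδE hα1
  have hB₀ : 0 < (2 * (BE * B6.c1 d' δE (1 - α) * (((ℓ + 1 : ℕ) : ℝ)) ^ 4)) := by positivity
  have hc1 : 0 ≤ B6.c1 d' δE (1 - α) := B6RandomWalk.c1_nonneg d' δE (1 - α)
  obtain ⟨a₀', ha₀', k₀, cα, hcα, H⟩ :=
    B8Thm2TorusOfProp6DeltaAFour.thm2TorusAtSU_ofProp6_deltaAFour_exists (hd := hd) (hL := hL) (len := len) hN hd2 hℓ τ hτ hτt hCτ hM1 hB₀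
      haT haTQ haT3 haT2 hεB b hM₂ hrepr Rr Hp h8'
  refine ⟨a₀', ha₀', k₀, cα, hcα, fun cL hcL hαe hcLP hcLα => ?_⟩
  obtain ⟨B₁, B₂, c₁, hB₁, hB₂, hc₁, HT⟩ := H cL hcL hαe hcLP hcLα
  exact ⟨B₁, B₂, c₁, hB₁, hB₂, hc₁, fun m K k η hk hkK hη hΔS =>
    HT m K k η hk hkK hη (deltaAFour_of_eBlockSym (instF := instF) d' hBE.le hκ hc1 hθ hgeo hΔS)⟩

end Torus

/-! ## §4 ★★★★★ The interface of record (G8∕G9) with the binder AT `parSymY`: Thm 2 at the COVER torus of every member `(F, n, K)`, `d + 1 = 3`, `SU(2)` -/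

section Cover

open B8Thm2SetupTorus (pow_dvd_period)
open B8Thm2T3FamilyBinder (P_eq_PV)
open T3ContinuumYM3Torus (T3Family)
open T3SectALandauChart (eta eta_pos)

variable {hd₃ : 1 ≤ 2 + 1}
variable [instF : ∀ i : KIdx 2 ℓ hd₃ hL 1 1, Fintype (geo9K i).Site] [instD : ∀ i : KIdx 2 ℓ hd₃ hL 1 1, DecidableEq (geo9K i).Site]

/-- ★★★★★ **G8∕G9 WITH THE BINDER AT `parSymY`**: [B8] Thm 2 (both halves) at the cover torus `PV 2 ℓ (F.m + k₀) K` of every member `(F, n, K)` + `P ∣ P′` + `L^{K−n} ∣ P`,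
`d + 1 = 3`, `N = 2`, at `B₀ := 2·B_E·c₁(d′, δ_E, 1−α)·L⁴`; displayed: `hgeo`, the window `2·(5·(B_E·c₁·L⁴)·κ) ≤ 1`, and per shape-member ∕ background (1ₛ), (Eₛ) (M5.7's endpoint
currency at `parSymY` VERBATIM), (J) the junction inequality.  Proof: G8's over §3.  HONEST SCOPE: (1ₛ), (Eₛ), (J), `hgeo` displayed; `stub_PV3A` NOT discharged; nothing
continuum ∕ ℝ⁴ ∕ OS — the Yang–Mills mass gap is NOT proved.
[cite: Balaban1985RegularSpaces, Thm 2 p.83, (1.29) p.81, (1.33)–(1.39) pp.82–83, p.77, (1.58)–(1.60) pp.86–87; Balaban1985BackgroundPropagators, p.408 l.30–34, (3.19) p.393, (3.25)–(3.27) p.395, (3.40) p.397, (3.42) p.397, (3.47) p.398, Thm 3.3 p.399, (3.101) p.414, (3.106) p.414, Thm 3.11 p.416; Balaban1984PropagatorsII, (2.50) p.232, Lemma 2.1 (2.60)–(2.61) p.234, (2.66) p.234; Balaban1985UV3, (1)–(3) p.256] -/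
theorem hThm2Cover_of_prop6_eBlockSym (hℓ : 4 ≤ ℓ)
    (τ : Matrix (Fin 2) (Fin 2) ℂ →ₗ[ℂ] ℂ) (hτ : ∀ a, τ a = Matrix.trace a) (hτt : ∀ a b, τ (a * b) = τ (b * a))
    {Cτ : ℝ} (hCτ : ∀ x y : Matrix (Fin 2) (Fin 2) ℂ, |(τ (star x * y)).re| ≤ Cτ * ‖x‖ * ‖y‖)
    {M : ℝ} (hM1 : 1 ≤ M) (d' : ℕ) {Rg : ℝ} {Hg : Prop} {δE α BE κ aT : ℝ} (hBE : 0 < BE) (hδE : 0 < δE) (hα1 : α < 1) (hκ : 0 ≤ κ)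
    (hθ : 2 * (((((2 : ℕ) : ℝ) + 3) * (BE * B6.c1 d' δE (1 - α) * (((ℓ + 1 : ℕ) : ℝ)) ^ 4)) * κ) ≤ 1)
    (haT : 0 < aT) (haTQ : aT ≤ alphaQ (2 + 1) (ℓ + 1) / ((ℓ + 1 : ℕ) : ℝ) ^ 2)
    (haT3 : C0 (2 + 1) * aT ≤ 1 / 3) (haT2 : 2 * aT ≤ c2' (2 + 1) (ℓ + 1))
    (hεB : 2 * ((48 * (((2 : ℕ) : ℝ) + 1) + 14 * ((2 : ℕ) : ℝ) * M + (32 * (((2 : ℕ) : ℝ) + 2) ^ 2 +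
        12 * (((2 : ℕ) : ℝ) + 1) ^ 2 * (13344 * (((2 : ℕ) : ℝ) + 1) * (((2 : ℕ) : ℝ) + 2) ^ 2 * (((2 : ℕ) : ℝ) + 5) * (((ℓ + 1 : ℕ) : ℝ)) ^ (2 + 4)) *
          (Cτ * (letI : CStarAlgebra (Matrix (Fin 2) (Fin 2) ℂ) := {}; betaTau τ)))) * aT) * (2 * (BE * B6.c1 d' δE (1 - α) * (((ℓ + 1 : ℕ) : ℝ)) ^ 4)) ≤ 1)
    {len : LSite (2 + 1) → ℝ}
    {ι : Type} [Fintype ι] [DecidableEq ι] (b : Module.Basis ι ℝ (Matrix (Fin 2) (Fin 2) ℂ)) {M₂ : ℝ} (hM₂ : 0 ≤ M₂)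
    (hrepr : ∀ (v : Matrix (Fin 2) (Fin 2) ℂ) (j : ι), |b.repr v j| ≤ M₂ * ‖v‖) (Rr : ℝ) (Hp : Prop) {a' : ℕ} (h8' : 8 ≤ (ℓ + 1) ^ a')
    (hgeo : ∀ i : KIdx 2 ℓ hd₃ hL 1 1, i.Mh = (ℓ + 1) ^ a' →
      Ineq260 (toB6 (geo9K i) Rg Hg) δE α ∧ Ineq261 d' (toB6 (geo9K i) Rg Hg) δE (1 - α) ∧
      4 * Real.log (geo9K i).L ≤ α * δE * Rg * (geo9K i).M) :
    letI : CStarAlgebra (Matrix (Fin 2) (Fin 2) ℂ) := {}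
    ∃ a₀' : ℝ, 0 < a₀' ∧ ∃ k₀ : ℕ, ∃ cα : ℝ, 0 < cα ∧
    ∀ cL : ℝ, 0 < cL → cL * (((ℓ + 1 : ℕ) : ℝ)) ^ 2 < a₀' →
      cL ≤ min (1 / 16) (min aT (min aT (1 / (2 * (2 * (2 * (BE * B6.c1 d' δE (1 - α) * (((ℓ + 1 : ℕ) : ℝ)) ^ 4))) * (14 * ((2 + 1 - 1 : ℕ) : ℝ)) * M + 1)))) →
      cL ≤ cα →
    ∃ B₁ B₂ c₁ : ℝ, 0 < B₁ ∧ 0 < B₂ ∧ 0 < c₁ ∧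
    ∀ F : T3Family, F.L = ℓ + 1 → ∀ (n K : ℕ), n < K →
      (∀ (i : KIdx 2 ℓ hd₃ hL 1 1) (m' : ℕ), 1 ≤ m' → m' ≤ K - n → i.k = m' + 1 → (∀ x, i.D.lev x = m') → i.Mh = (ℓ + 1) ^ a' →
        i.cf = (((ℓ + 1 : ℕ) : ℝ)) ^ (m' + 1) →
        (∀ ι : IBondY i, i.w ι = i.cf ^ 2 * (((((ℓ + 1 : ℕ) : ℝ)) ^ (ι.1.1 : ℕ)) ^ (2 + 1) * (1 / (((ℓ + 1 : ℕ) : ℝ)) ^ (ι.1.1 : ℕ)) ^ 2)) →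
        (PV 2 ℓ i.m i.K hd₃ hL).sitesPerDir 0 = (PV 2 ℓ (F.m + k₀) K hd₃ hL).sitesPerDir 0 →
        ∀ (α₀ : ℝ) (U₀ : LSite (2 + 1) → Fin (2 + 1) → (Matrix (Fin 2) (Fin 2) ℂ)ˣ),
        (∀ x κ, U₀ x κ ∈ B7Prop2Explicit.unitaryUnits (Matrix (Fin 2) (Fin 2) ℂ)) →
        IsPeriodic ((PV 2 ℓ (F.m + k₀) K hd₃ hL).sitesPerDir 0) U₀ → 0 < α₀ → α₀ ≤ aT →
        InAk (ℓ + 1) m' (eta F n K) α₀ (fun _ => (Set.univ : Set (LSite (2 + 1)))) U₀ →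
          IsUnit (deltaAY i (parSymY i) (parBY i) (GpY i (parSymY i)) (bgY i U₀)) ∧
          (∀ (B : B9.Backgrounds) (cfg : B.Cfg → CfgY (Matrix (Fin 2) (Fin 2) ℂ) i) (par : BondParY (Matrix (Fin 2) (Fin 2) ℂ) i) (U₁ : B.Cfg),
            cfg U₁ = bgY i U₀ →
            EBlock (kernelFamilyBInv i B cfg (GAY i (parSymY i) (parBY i) (GpY i (parSymY i))) par) BE δE U₁) ∧
          (∀ A, wNormBY i (-3) ((DPDsY i (parSymY i) (GpY i (parSymY i)) (bgY i U₀) - DPDsY i (parKnitY i) (GpY i (parKnitY i)) (bgY i U₀)) A) ≤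
            κ * wNormBY i (-1) A)) →
      (((F.P K).sitesPerDir 0 : ℕ) : ℤ) ∣ (((PV 2 ℓ (F.m + k₀) K hd₃ hL).sitesPerDir 0 : ℕ) : ℤ) ∧
      (((ℓ + 1 : ℕ) : ℤ)) ^ (K - n) ∣ (((F.P K).sitesPerDir 0 : ℕ) : ℤ) ∧
      Thm2TorusAt (ℓ + 1) (K - n) ((((PV 2 ℓ (F.m + k₀) K hd₃ hL).sitesPerDir 0 : ℕ) : ℤ)) (eta F n K) 0 B₁ B₂ c₁ len
        (specialUnitaryUnits (Fin 2)) (fun _ => True) := by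
  letI : CStarAlgebra (Matrix (Fin 2) (Fin 2) ℂ) := {}
  obtain ⟨a₀', ha₀', k₀, cα, hcα, H⟩ :=
    thm2TorusAtSU_ofProp6_eBlockSym_exists (d := 2) (hd := hd₃) (hL := hL) (len := len) (by norm_num) (by norm_num) hℓ τ hτ hτt hCτ hM1 d' hBE hδE hα1
      hκ hθ haT haTQ haT3 haT2 hεB b hM₂ hrepr Rr Hp h8' hgeo
  refine ⟨a₀', ha₀', k₀, cα, hcα, fun cL hcL hαe hcLP hcLα => ?_⟩
  obtain ⟨B₁, B₂, c₁, hB₁, hB₂, hc₁, HT⟩ := H cL hcL hαe hcLP hcLα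
  refine ⟨B₁, B₂, c₁, hB₁, hB₂, hc₁, fun F hF n K hnK hΔ => ⟨?_, ?_, ?_⟩⟩
  · rw [P_eq_PV (hd := hd₃) (hL := hL) F hF K]
    show ((2 * (ℓ + 1) ^ (F.m + K - 0) : ℕ) : ℤ) ∣ ((2 * (ℓ + 1) ^ (F.m + k₀ + K - 0) : ℕ) : ℤ)
    rw [Nat.sub_zero, Nat.sub_zero]
    exact_mod_cast mul_dvd_mul_left 2 (pow_dvd_pow (ℓ + 1) (show F.m + K ≤ F.m + k₀ + K by omega))
  · rw [P_eq_PV (hd := hd₃) (hL := hL) F hF K]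
    exact pow_dvd_period (PV 2 ℓ F.m K hd₃ hL) (j := 0) (k := K - n) (show K - n ≤ F.m + K - 0 by omega)
  · exact HT (F.m + k₀) K (K - n) (eta F n K) (by omega) (by omega) (eta_pos F n K) hΔ

/-! ## §5 ★★★★★ The geometric data discharged: the interface AT `parSymY`, `∃ d′ A₀, ∀ a′ ≥ A₀` -/

/-- ★★★★★ **THE TORUS THM 2 INTERFACE WITH THE BINDER AT `parSymY`, GEOMETRY DISCHARGED**: for `τ = tr`, `M ≥ 1`, rates `δ_E > 0`, `0 < α < 1`, `len`, a basis `b`, `Rr, Hp, Hg`: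
THERE ARE `d′` and `A₀` such that for every `a′ ≥ A₀`, every `B_E > 0` and junction constant `κ ≥ 0` with `2·(5·(B_E·c₁(d′,δ_E,1−α)·L⁴)·κ) ≤ 1`, every `a_T` in the windows with F7's
numeric condition at `B₀ := 2·B_E·c₁(d′,δ_E,1−α)·L⁴`: `∃ a₀′ > 0, ∃ k₀, ∃ c_α > 0, ∀ c_L …, ∃ B₁ B₂ c₁ > 0, ∀ F : T3Family, F.L = ℓ + 1 → ∀ n < K`, [(1ₛ) ∧ (Eₛ) ∧ (J) at the cover
torus' shape-members] → `P ∣ P′ ∧ L^{K−n} ∣ P ∧ Thm2TorusAt (ℓ+1) (K − n) P′ (eta F n K) 0 B₁ B₂ c₁ len SU(2) ⊤`.  After JB-BOND file 2 lands (p38: (J) with an explicit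
`κ(a_T) → 0`), file 5 removes (J) and the interface displays M5.7's endpoint at `parSymY` ALONE.  HONEST SCOPE: (1ₛ), (Eₛ), (J) displayed; `stub_PV3A` NOT discharged; no
summit ∕ node statement proved; nothing continuum ∕ ℝ⁴ ∕ OS — the Yang–Mills mass gap is NOT proved by any of this.
[cite: Balaban1985RegularSpaces, Thm 2 p.83, (1.29) p.81, (1.33)–(1.39) pp.82–83, p.77, (1.58)–(1.60) pp.86–87; Balaban1985BackgroundPropagators, p.408 l.30–34, (3.19) p.393, (3.25)–(3.27) p.395, (3.40) p.397, (3.42) p.397, (3.47) p.398, Thm 3.3 p.399, (3.101) p.414, (3.106) p.414, Thm 3.11 p.416; Balaban1984PropagatorsII, (2.50) p.232, Lemma 2.1 (2.59)–(2.61) pp.233–234, (2.66) p.234; Balaban1985UV3, (1)–(3) p.256] -/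
theorem hThm2Cover_of_prop6_eBlockSym_exists (hℓ : 4 ≤ ℓ)
    (τ : Matrix (Fin 2) (Fin 2) ℂ →ₗ[ℂ] ℂ) (hτ : ∀ a, τ a = Matrix.trace a) (hτt : ∀ a b, τ (a * b) = τ (b * a))
    {Cτ : ℝ} (hCτ : ∀ x y : Matrix (Fin 2) (Fin 2) ℂ, |(τ (star x * y)).re| ≤ Cτ * ‖x‖ * ‖y‖)
    {M : ℝ} (hM1 : 1 ≤ M) {δE α : ℝ} (hδE : 0 < δE) (hα0 : 0 < α) (hα1 : α < 1)
    {len : LSite (2 + 1) → ℝ}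
    {ι : Type} [Fintype ι] [DecidableEq ι] (b : Module.Basis ι ℝ (Matrix (Fin 2) (Fin 2) ℂ)) {M₂ : ℝ} (hM₂ : 0 ≤ M₂)
    (hrepr : ∀ (v : Matrix (Fin 2) (Fin 2) ℂ) (j : ι), |b.repr v j| ≤ M₂ * ‖v‖) (Rr : ℝ) (Hp Hg : Prop) :
    letI : CStarAlgebra (Matrix (Fin 2) (Fin 2) ℂ) := {}
    ∃ d' A₀ : ℕ, ∀ a' : ℕ, A₀ ≤ a' → ∀ BE : ℝ, 0 < BE → ∀ κ : ℝ, 0 ≤ κ →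
    2 * (((((2 : ℕ) : ℝ) + 3) * (BE * B6.c1 d' δE (1 - α) * (((ℓ + 1 : ℕ) : ℝ)) ^ 4)) * κ) ≤ 1 →
    ∀ aT : ℝ, 0 < aT → aT ≤ alphaQ (2 + 1) (ℓ + 1) / ((ℓ + 1 : ℕ) : ℝ) ^ 2 → C0 (2 + 1) * aT ≤ 1 / 3 → 2 * aT ≤ c2' (2 + 1) (ℓ + 1) →
      2 * ((48 * (((2 : ℕ) : ℝ) + 1) + 14 * ((2 : ℕ) : ℝ) * M + (32 * (((2 : ℕ) : ℝ) + 2) ^ 2 +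
        12 * (((2 : ℕ) : ℝ) + 1) ^ 2 * (13344 * (((2 : ℕ) : ℝ) + 1) * (((2 : ℕ) : ℝ) + 2) ^ 2 * (((2 : ℕ) : ℝ) + 5) * (((ℓ + 1 : ℕ) : ℝ)) ^ (2 + 4)) *
          (Cτ * betaTau τ))) * aT) * (2 * (BE * B6.c1 d' δE (1 - α) * (((ℓ + 1 : ℕ) : ℝ)) ^ 4)) ≤ 1 →
    ∃ a₀' : ℝ, 0 < a₀' ∧ ∃ k₀ : ℕ, ∃ cα : ℝ, 0 < cα ∧
    ∀ cL : ℝ, 0 < cL → cL * (((ℓ + 1 : ℕ) : ℝ)) ^ 2 < a₀' →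
      cL ≤ min (1 / 16) (min aT (min aT (1 / (2 * (2 * (2 * (BE * B6.c1 d' δE (1 - α) * (((ℓ + 1 : ℕ) : ℝ)) ^ 4))) * (14 * ((2 + 1 - 1 : ℕ) : ℝ)) * M + 1)))) →
      cL ≤ cα →
    ∃ B₁ B₂ c₁ : ℝ, 0 < B₁ ∧ 0 < B₂ ∧ 0 < c₁ ∧
    ∀ F : T3Family, F.L = ℓ + 1 → ∀ (n K : ℕ), n < K →
      (∀ (i : KIdx 2 ℓ hd₃ hL 1 1) (m' : ℕ), 1 ≤ m' → m' ≤ K - n → i.k = m' + 1 → (∀ x, i.D.lev x = m') → i.Mh = (ℓ + 1) ^ a' →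
        i.cf = (((ℓ + 1 : ℕ) : ℝ)) ^ (m' + 1) →
        (∀ ι : IBondY i, i.w ι = i.cf ^ 2 * (((((ℓ + 1 : ℕ) : ℝ)) ^ (ι.1.1 : ℕ)) ^ (2 + 1) * (1 / (((ℓ + 1 : ℕ) : ℝ)) ^ (ι.1.1 : ℕ)) ^ 2)) →
        (PV 2 ℓ i.m i.K hd₃ hL).sitesPerDir 0 = (PV 2 ℓ (F.m + k₀) K hd₃ hL).sitesPerDir 0 →
        ∀ (α₀ : ℝ) (U₀ : LSite (2 + 1) → Fin (2 + 1) → (Matrix (Fin 2) (Fin 2) ℂ)ˣ),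
        (∀ x κ, U₀ x κ ∈ B7Prop2Explicit.unitaryUnits (Matrix (Fin 2) (Fin 2) ℂ)) →
        IsPeriodic ((PV 2 ℓ (F.m + k₀) K hd₃ hL).sitesPerDir 0) U₀ → 0 < α₀ → α₀ ≤ aT →
        InAk (ℓ + 1) m' (eta F n K) α₀ (fun _ => (Set.univ : Set (LSite (2 + 1)))) U₀ →
          IsUnit (deltaAY i (parSymY i) (parBY i) (GpY i (parSymY i)) (bgY i U₀)) ∧
          (∀ (B : B9.Backgrounds) (cfg : B.Cfg → CfgY (Matrix (Fin 2) (Fin 2) ℂ) i) (par : BondParY (Matrix (Fin 2) (Fin 2) ℂ) i) (U₁ : B.Cfg),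
            cfg U₁ = bgY i U₀ →
            EBlock (kernelFamilyBInv i B cfg (GAY i (parSymY i) (parBY i) (GpY i (parSymY i))) par) BE δE U₁) ∧
          (∀ A, wNormBY i (-3) ((DPDsY i (parSymY i) (GpY i (parSymY i)) (bgY i U₀) - DPDsY i (parKnitY i) (GpY i (parKnitY i)) (bgY i U₀)) A) ≤
            κ * wNormBY i (-1) A)) →
      (((F.P K).sitesPerDir 0 : ℕ) : ℤ) ∣ (((PV 2 ℓ (F.m + k₀) K hd₃ hL).sitesPerDir 0 : ℕ) : ℤ) ∧
      (((ℓ + 1 : ℕ) : ℤ)) ^ (K - n) ∣ (((F.P K).sitesPerDir 0 : ℕ) : ℤ) ∧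
      Thm2TorusAt (ℓ + 1) (K - n) ((((PV 2 ℓ (F.m + k₀) K hd₃ hL).sitesPerDir 0 : ℕ) : ℤ)) (eta F n K) 0 B₁ B₂ c₁ len
        (specialUnitaryUnits (Fin 2)) (fun _ => True) := by
  letI : CStarAlgebra (Matrix (Fin 2) (Fin 2) ℂ) := {}
  obtain ⟨d', A₀, h8, hgeo⟩ := exists_geo_threshold (d := 2) (hd := hd₃) (hL := hL) (b₀' := (1 : ℝ)) (b₁' := (1 : ℝ)) (instF' := instF)
    (by omega) hδE hα0 hα1 Hg
  refine ⟨d', A₀, fun a' ha' BE hBE κ hκ hθ aT haT haTQ haT3 haT2 hεB => ?_⟩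
  have h8' : 8 ≤ (ℓ + 1) ^ a' := h8.trans (Nat.pow_le_pow_right (Nat.succ_pos ℓ) ha')
  exact hThm2Cover_of_prop6_eBlockSym (hd₃ := hd₃) (hL := hL) (len := len) hℓ τ hτ hτt hCτ hM1 d' (Rg := 1) (Hg := Hg) hBE hδE hα1 hκ hθ haT haTQ
    haT3 haT2 hεB b hM₂ hrepr Rr Hp h8' (hgeo a' ha')

end Cover

end Literature.MathematicalPhysics.QuantumFieldTheory.Balaban1983to89.B8Thm2TorusCoverOfEBlockSym

end
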